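import Mathlib.Tactic
import Literature.Computability.QuantumComplexity.BQPMajorityAmplification
import Literature.Computability.Cryptography.ClassBQP
import Literature.Computability.Complexity.Promise
import Summits.QuantumAdvantage.QuantumAdvantage.Statement
import Summits.QuantumAdvantage.QuantumAdvantage.Theorems.SoloInformedPseudoDeterministicLift
import HarnessLib

/-!
# SoloInformedCanonicalBit — `Q-EXT` ⟺ canonical-bit estimators ⟺ the threshold problems lift

Solo seat `solo-QuantumAdvantage-informed` (ideation tier, summit-directed); closes claim C1 of the seat at
precision `1/6`: the quantum analogue of Dixon–Pavan–Vander Woude–Vinodchandran 2022, Thm. 2.1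
("APEP has a pseudo-deterministic approximation algorithm iff every promise problem of PromiseBPP has a
solution in BPP"), in the tree's uniform Clifford+`T` model. With `Q-EXT := PromiseBQP ⊆ promiseLift BQP`:

* `isQSolvable_bit_of_mem_BQP` — decision to search: for `L ∈ BQP`, the bit function `x ↦ [x ∈ L]` is
  `IsQSolvable` (`27` parallel copies and the majority read-out, `PostBQPAmp.kernelProb_maj_true_ge` /
  `_false_ge`, classical wrap `CWrap.family`; the converse of the tree's `mem_BQP_of_isQSolvable_bit`);
* `canonicalBit_of_thresholdLift` — if the threshold problem `⟨{x | 7/12 ≤ p_F x}, {x | p_F x ≤ 5/12}⟩` of a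
  uniform family `F` is solved by a `BQP` language `L`, then `F` has a CANONICAL-BIT ESTIMATOR: a value
  `v` with `|v - p_F| < 1/6` whose rounding bit `[1/2 ≤ v] = [· ∈ L]` is `IsQSolvable`;
* `symmThresholdPromise_mem_PromiseBQP` — that threshold problem is in `PromiseBQP` (majority amplification,
  `exists_majority_amplified`, margin `1/12`, `108` copies);
* `canonicalBit_of_promiseIsLift` — `Q-EXT ⇒` every uniform family has a canonical-bit estimator;
* **`promiseIsLift_iff_canonicalBit`** — `Q-EXT ⟺` canonical-bit estimators exist for all uniform families
  (with `promiseBQP_subset_promiseLift_of_canonicalBit` of `SoloInformedPseudoDeterministicLift`);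
* **`promiseIsLift_iff_thresholdLift`** — `Q-EXT` is equivalent to its restriction to the symmetric
  threshold problems of uniform families: it suffices to lift `⟨{7/12 ≤ p_F}, {p_F ≤ 5/12}⟩` for every `F`.

[cite: DixonPavanVanderWoudeVinodchandran2022, Thm. 2.1] [cite: Goldreich2006, Def. 1.2]
[cite: BennettBernsteinBrassardVazirani1997, Thm. 4.13]
-/

noncomputable section

namespace Summit.QuantumAdvantage.QuantumAdvantage.Theorems

open _root_.Computability Literature.Computability.Complexity Literature.Computability.Cryptography
  Literature.Computability.QuantumComplexity

/-- **Decision to search**: for `L ∈ BQP` and `bit x = [x ∈ L]`, the bit function `x ↦ [bit x]` is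
`IsQSolvable` — `27` parallel copies of a decider followed by the classical majority read-out write the
right bit first with probability `≥ 1 - 1/(4·27·(1/6)²) = 2/3`. [cite: BennettBernsteinBrassardVazirani1997, Thm. 4.13] -/
theorem isQSolvable_bit_of_mem_BQP {L : Language Bool} (hL : L ∈ BQP) {bit : List Bool → Bool}
    (hbit : ∀ x, bit x = true ↔ x ∈ L) : IsQSolvable fun x => {z | [bit x] <+: z} := by
  obtain ⟨F, hF, hU, hFx⟩ := ClassBQP.mem_BQP_iff.1 hL
  obtain ⟨pF, hpF⟩ := QCircuitFamily.IsUniform.isPolySize' hU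
  let P₀ : PostBQPAmp.Params := ⟨F, pF, fun n => (hpF n).2, 27, by norm_num⟩
  have hK : P₀.K = 27 := rfl
  have hRfree : (PostBQPAmp.family P₀).IsOracleFree := PostBQPAmp.family_isOracleFree P₀ hF
  have hRU : (PostBQPAmp.family P₀).IsUniform := PostBQPAmp.family_isUniform P₀ hU
  obtain ⟨P, hPh, hPg, hPF⟩ :=
    CWrap.exists_params (PolyTimeComputable.id _) (PostBQPAmp.maj_mem_FP P₀) hRU
  refine ⟨CWrap.family P, CWrap.family_isOracleFree P (hPF ▸ hRfree), CWrap.family_isUniform P (hPF ▸ hRU),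
    fun x => ?_⟩
  have hη : (0 : ℝ) < 1 / 6 := by norm_num
  show 2 / 3 ≤ (CWrap.family P).kernelProb 0 x {z | [bit x] <+: z}
  cases hb : bit x
  · -- `bit x = false`: `x ∉ L`, one copy accepts with probability `≤ 1/3 = 1/2 - 1/6`
    have hxL : x ∉ L := fun h => by rw [(hbit x).2 h] at hb; exact Bool.noConfusion hb
    have hx : F.acceptProbOn 0 x ≤ 1 / 2 - 1 / 6 := by have := (hFx x).2 hxL; linarith
    have hker := CWrap.kernelProb_family_ge P x
      (fun _ => {y | PostBQPAmp.maj P₀ (boolPair x y) = [false]})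
    rw [hPh, hPg, hPF] at hker
    have hsub : {z | ∃ y ∈ ({y | PostBQPAmp.maj P₀ (boolPair x y) = [false]} : Set (List Bool)),
        PostBQPAmp.maj P₀ (boolPair x y) <+: z} ⊆ {z | [false] <+: z} := by
      rintro z ⟨y, hy, hz⟩
      rw [Set.mem_setOf_eq] at hy
      rw [hy] at hz
      exact hz
    have h1 := ((PostBQPAmp.kernelProb_maj_false_ge (P := P₀) x hη hx).trans hker).trans
      ((CWrap.family P).kernelProb_mono 0 x hsub)
    rw [hK] at h1
    norm_num at h1
    exact h1
  · -- `bit x = true`: `x ∈ L`, one copy accepts with probability `≥ 2/3 = 1/2 + 1/6`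
    have hxL : x ∈ L := (hbit x).1 hb
    have hx : 1 / 2 + 1 / 6 ≤ F.acceptProbOn 0 x := by have := (hFx x).1 hxL; linarith
    have hker := CWrap.kernelProb_family_ge P x
      (fun _ => {y | PostBQPAmp.maj P₀ (boolPair x y) = [true]})
    rw [hPh, hPg, hPF] at hker
    have hsub : {z | ∃ y ∈ ({y | PostBQPAmp.maj P₀ (boolPair x y) = [true]} : Set (List Bool)),
        PostBQPAmp.maj P₀ (boolPair x y) <+: z} ⊆ {z | [true] <+: z} := by
      rintro z ⟨y, hy, hz⟩
      rw [Set.mem_setOf_eq] at hy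
      rw [hy] at hz
      exact hz
    have h1 := ((PostBQPAmp.kernelProb_maj_true_ge (P := P₀) x hη hx).trans hker).trans
      ((CWrap.family P).kernelProb_mono 0 x hsub)
    rw [hK] at h1
    norm_num at h1
    exact h1

/-- **Canonical-bit estimator from a lift of the threshold problem.** If a `BQP` language `L` solves the
threshold promise problem `⟨{x | 7/12 ≤ p_F x}, {x | p_F x ≤ 5/12}⟩` of the family `F`, then
`v x := max (p_F x) (1/2)` on `L` and `min (p_F x) (1/2) - 1/12` off `L` is within `< 1/6` of `p_F`, its
rounding bit `[1/2 ≤ v x] = [x ∈ L]` is canonical, and computing that bit is `IsQSolvable`.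
[cite: DixonPavanVanderWoudeVinodchandran2022, Thm. 2.1 (proof, ⇐)] [cite: Goldreich2006, Def. 1.2] -/
theorem canonicalBit_of_thresholdLift (F : QCircuitFamily cliffordT)
    (hlift : (⟨{x | 7 / 12 ≤ F.acceptProbOn 0 x}, {x | F.acceptProbOn 0 x ≤ 5 / 12}⟩ : PromiseProblem) ∈
      promiseLift BQP) :
    ∃ (v : List Bool → ℝ) (bit : List Bool → Bool),
      (∀ x, |v x - F.acceptProbOn 0 x| < 1 / 6) ∧ (∀ x, bit x = true ↔ 1 / 2 ≤ v x) ∧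
      IsQSolvable fun x => {z | [bit x] <+: z} := by
  classical
  obtain ⟨L, hL, hyes, hno⟩ := hlift
  refine ⟨fun x => if x ∈ L then max (F.acceptProbOn 0 x) (1 / 2) else min (F.acceptProbOn 0 x) (1 / 2) - 1 / 12,
    fun x => decide (x ∈ L), fun x => ?_, fun x => ?_,
    isQSolvable_bit_of_mem_BQP hL fun x => by simp only [decide_eq_true_eq]⟩
  · beta_reduce
    by_cases hxL : x ∈ L
    · -- on `L` the input is not a no-instance: `p > 5/12`
      have hgt : 5 / 12 < F.acceptProbOn 0 x := by
        by_contra h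
        exact (hno (not_lt.1 h)) hxL
      rw [if_pos hxL]
      rcases le_or_gt (1 / 2 : ℝ) (F.acceptProbOn 0 x) with h | h
      · rw [max_eq_left h, sub_self, abs_zero]; norm_num
      · rw [max_eq_right h.le, abs_of_nonneg (by linarith)]; linarith
    · -- off `L` the input is not a yes-instance: `p < 7/12`
      have hlt : F.acceptProbOn 0 x < 7 / 12 := by
        by_contra h
        exact hxL (hyes (not_lt.1 h))
      rw [if_neg hxL]
      rcases le_or_gt (F.acceptProbOn 0 x) (1 / 2 : ℝ) with h | h
      · rw [min_eq_left h, abs_of_neg (by linarith)]; linarith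
      · rw [min_eq_right h.le, abs_of_neg (by linarith)]; linarith
  · simp only [decide_eq_true_eq]
    by_cases hxL : x ∈ L
    · simp only [hxL, if_true, true_iff]
      exact le_max_right _ _
    · simp only [hxL, if_false, false_iff, not_le]
      have := min_le_right (F.acceptProbOn 0 x) (1 / 2 : ℝ)
      linarith

/-- **The symmetric threshold problem of a uniform family is in `PromiseBQP`**:
`⟨{x | 7/12 ≤ p_F x}, {x | p_F x ≤ 5/12}⟩ ∈ PromiseBQP`, by the tree's majority-vote amplification
`exists_majority_amplified` with margin `η = 1/12` and `K = 108` copies (error `1/(4·108/144) = 1/3`).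
(The general shifted-threshold form is `thresholdPromise_mem_PromiseBQP` of
`SoloInformedThresholdAmplification`.) [cite: BennettBernsteinBrassardVazirani1997, Thm. 4.13] [cite: Watrous2009, §III.1] -/
theorem symmThresholdPromise_mem_PromiseBQP {F : QCircuitFamily cliffordT} (hF : F.IsOracleFree)
    (hU : F.IsUniform) :
    (⟨{x | 7 / 12 ≤ F.acceptProbOn 0 x}, {x | F.acceptProbOn 0 x ≤ 5 / 12}⟩ : PromiseProblem) ∈
      PromiseBQP := by
  obtain ⟨F', hF', hU', hF'x⟩ :=
    exists_majority_amplified hF hU (K := 108) (by norm_num) (η := 1 / 12) (by norm_num)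
  refine ⟨F', hF', hU', fun x hx => ?_, fun x hx => ?_⟩
  · have hx' : 1 / 2 + 1 / 12 ≤ F.acceptProbOn 0 x := by
      have : 7 / 12 ≤ F.acceptProbOn 0 x := hx
      linarith
    have h := (hF'x x).1 hx'
    norm_num at h ⊢
    linarith
  · have hx' : F.acceptProbOn 0 x ≤ 1 / 2 - 1 / 12 := by
      have : F.acceptProbOn 0 x ≤ 5 / 12 := hx
      linarith
    have h := (hF'x x).2 hx'
    norm_num at h ⊢
    linarith

/-- **`Q-EXT ⇒` canonical-bit estimators**: under `PromiseBQP ⊆ promiseLift BQP` every uniform oracle-free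
family has a canonical-bit estimator (its `(7/12, 5/12)` threshold problem lies in `PromiseBQP` by
`symmThresholdPromise_mem_PromiseBQP`, hence lifts). [cite: DixonPavanVanderWoudeVinodchandran2022, Thm. 2.1 (⇐)] -/
theorem canonicalBit_of_promiseIsLift (hExt : PromiseBQP ⊆ promiseLift BQP)
    (F : QCircuitFamily cliffordT) (hF : F.IsOracleFree) (hU : F.IsUniform) :
    ∃ (v : List Bool → ℝ) (bit : List Bool → Bool),
      (∀ x, |v x - F.acceptProbOn 0 x| < 1 / 6) ∧ (∀ x, bit x = true ↔ 1 / 2 ≤ v x) ∧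
      IsQSolvable fun x => {z | [bit x] <+: z} :=
  canonicalBit_of_thresholdLift F (hExt (symmThresholdPromise_mem_PromiseBQP hF hU))

/-- **`Q-EXT ⟺` canonical-bit estimators** (quantum Dixon–Pavan–Vander Woude–Vinodchandran, precision
`1/6`): every `PromiseBQP` problem is solved by a `BQP` language iff every uniform oracle-free Clifford+`T`
family admits a value `v` within `< 1/6` of its acceptance probability whose rounding bit `[1/2 ≤ v]` is
computed by an `IsQSolvable` (canonical-output, i.e. pseudo-deterministic) quantum algorithm.
[cite: DixonPavanVanderWoudeVinodchandran2022, Thm. 2.1] -/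
theorem promiseIsLift_iff_canonicalBit :
    PromiseBQP ⊆ promiseLift BQP ↔
      ∀ F : QCircuitFamily cliffordT, F.IsOracleFree → F.IsUniform →
        ∃ (v : List Bool → ℝ) (bit : List Bool → Bool),
          (∀ x, |v x - F.acceptProbOn 0 x| < 1 / 6) ∧ (∀ x, bit x = true ↔ 1 / 2 ≤ v x) ∧
          IsQSolvable fun x => {z | [bit x] <+: z} :=
  ⟨fun h F hF hU => canonicalBit_of_promiseIsLift h F hF hU,
    fun h => promiseBQP_subset_promiseLift_of_canonicalBit h⟩

/-- **`Q-EXT` reduces to the symmetric threshold problems**: every `PromiseBQP` problem is solved by a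
`BQP` language iff, for every uniform oracle-free family `F`, the single promise problem
`⟨{x | 7/12 ≤ p_F x}, {x | p_F x ≤ 5/12}⟩` is. [cite: DixonPavanVanderWoudeVinodchandran2022, Thm. 2.1]
[cite: Goldreich2006, Def. 1.2] -/
theorem promiseIsLift_iff_thresholdLift :
    PromiseBQP ⊆ promiseLift BQP ↔
      ∀ F : QCircuitFamily cliffordT, F.IsOracleFree → F.IsUniform →
        (⟨{x | 7 / 12 ≤ F.acceptProbOn 0 x}, {x | F.acceptProbOn 0 x ≤ 5 / 12}⟩ : PromiseProblem) ∈
          promiseLift BQP :=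
  ⟨fun h _ hF hU => h (symmThresholdPromise_mem_PromiseBQP hF hU),
    fun h => promiseBQP_subset_promiseLift_of_canonicalBit fun F hF hU =>
      canonicalBit_of_thresholdLift F (h F hF hU)⟩

/-- **Summit form.** `QuantumAdvantage` follows from: the symmetric threshold problems of uniform families
lift to `BQP` languages, and some `PromiseBQP` problem is solved by no `BPP` language.
[cite: DixonPavanVanderWoudeVinodchandran2022, Thm. 2.1] [cite: Goldreich2006, Def. 1.2] -/
theorem quantumAdvantage_of_thresholdLift
    (hthr : ∀ F : QCircuitFamily cliffordT, F.IsOracleFree → F.IsUniform →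
      (⟨{x | 7 / 12 ≤ F.acceptProbOn 0 x}, {x | F.acceptProbOn 0 x ≤ 5 / 12}⟩ : PromiseProblem) ∈
        promiseLift BQP)
    (hSep : ¬ PromiseBQP ⊆ PromiseBPP) : QuantumAdvantage :=
  quantumAdvantage_of_promiseIsLift (promiseIsLift_iff_thresholdLift.2 hthr) hSep

end Summit.QuantumAdvantage.QuantumAdvantage.Theorems

end
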